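import Mathlib
import Summits.FinalStateConjecture.FinalStateConjecture.Theses.PhaseMixingCapture
import Literature.Geometry.Lorentzian.TameGenericityDiagonal
import Literature.Geometry.Lorentzian.TameGenericityLocal
import Literature.Geometry.Lorentzian.AdiabaticTracking
import Summits.FinalStateConjecture.FinalStateConjecture.Theorems.PhaseMixingCaptureCaptureSufficesC2StubSelfWitnesses
import Summits.FinalStateConjecture.FinalStateConjecture.Theorems.PhaseMixingCaptureCaptureSufficesC2SettlingTransport

/-!
# Line `censorship-enters-diagonally` — crux `CaptureSufficesC2` (stmt-FinalStateConjecture-14986,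
# route PhaseMixingCapture, rank 6) — skeleton v7 (lead c7, 2026-08-16T23:3xZ; v1 = crux-plan 21:38Z,
# v2 = curve form, v3 = end re-chosen + §8, v4 = stubs 2–3 SPLIT into KICK (genuine) + SELF-WITNESS (dischargeable),
# v5 = the two SELF-WITNESS stubs DISCHARGED by import of the landed Theorems module p129443 — 4 stubs remain,
# v6 = the two KICK stubs in LOCAL form: quiet / margin asked only of members with 0 < ‖c‖ < ε — strictly weaker,
#      same composition via the landed `InitialDataSet.exists_tameCurve_of_local` (TameGenericityLocal.lean, p130144),
# v7 = stub 4 RELAXED from the pointwise `stub_trackedCaptureSettles` to the relative LOCAL `stub_settlingKick`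
#      (settling kicks along MARGIN curves whose base does not settle), composed through the landed glue
#      `finalStateConjecture_of_genericMargin_of_settlingKick` (Theorems/…SettlingTransport.lean, p130476, lead c6);
#      the pointwise form stays as the documented stronger statement (`settlingKick_of_trackedCaptureSettles`))

## v7 (lead c7, 23:3xZ): STUB 4 RELATIVISED. The composition's last arrow was a pointwise `mono` by
## `stub_trackedCaptureSettles` (every admissible datum whose MGHDs have complete `𝓘⁺` and are margin-tracked settles —
## = item stmt-10853 repaired). v7 asks instead, exactly in the shape of the two kick stubs, for `stub_settlingKick`:
## along every tame admissible curve of MARGIN data (told immersed-injective or constant) whose base `F 0` does NOT have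
## the full summit property, a tame injective immersed admissible curve through `F 0` whose members with `0 < ‖c‖ < ε₀`
## have it. The self-witness half (base already settles) is the landed `summitSelfWitness` (breathing curve + transport of
## the settling clause, p130476), the localisation is the landed radial reparametrisation (p130144), and the last arrow
## becomes a third application of `isTameChristodoulouGeneric_of_relative'`. Strictly weaker than v6's stub 4
## (`settlingKick_of_trackedCaptureSettles`: the pointwise form gives the kick with `F' := F`, and is contradictory on
## constant margin curves), BN5-robust (the prover builds `F'` and knows its developments to all orders; no `C²`-only
## tracked MGHD has to be pinned), and still discharged in one line by a restated 10853. Registered stubs (4):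
## `stub_tameCensorship`, `stub_quietKick`, `stub_marginKick`, `stub_settlingKick`.

Crux (FIXED, concluded BY NAME in `CaptureSufficesC2_of`):
`PhaseMixingCapture.CaptureSufficesC2 := NearExtremalKappaCapture → BulkKerrCaptureC2 →
WeakCosmicCensorshipMGHD → FinalStateConjecture`.

## v6 (lead c6, 23:1xZ): KICK stubs LOCALISED. Every construction of kicked families is perturbative in the kick
## parameter, and tame genericity is local in the parameter (`Literature/…/TameGenericityLocal.lean`, p130144:
## radial reparametrisation `c ↦ ε(1+‖c‖²)^{-1/2} c` preserves tame / injective / IMMERSED / admissible and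
## the base datum). So `stub_quietKick` / `stub_marginKick` now ask for quiet (resp. margin) members only for
## `0 < ‖c‖ < ε` (some `ε > 0`); §5 recovers the v5 global forms (`quietKick_of_local`, `marginKick_of_local`)
## and the composition is unchanged. Each v6 stub is implied by its v5 form (`*_local_of_global`).
##
## v5 (lead c6, 22:5xZ): `stub_quietSelfWitness` / `stub_marginSelfWitness` are no longer stubs —
## they are the landed theorems of `Theorems/PhaseMixingCaptureCaptureSufficesC2StubSelfWitnesses.lean`
## (p129443, ACCEPTED; breathing curve + transport), imported. Registered stubs (4): `stub_tameCensorship`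
## (hypothesis-grade = rank 5 restated tame), `stub_quietKick` (HARDEST, the crux's dynamical core),
## `stub_marginKick` (third-law transversality in family form), `stub_trackedCaptureSettles` (= 10853-M1).
##
## v4 (lead a1, 22:4xZ): stubs 2–3 SPLIT by the base datum. `TameCurveWitnessAlong 𝓓 Q P` splits
## (`tameCurveWitnessAlong_of_kick_and_self`) into the KICK case — base `F 0` does NOT yet have `P`:
## `stub_quietKick`, `stub_marginKick`, the genuine dynamical content — and the SELF-WITNESS case —
## base already has `P`: `stub_quietSelfWitness`, `stub_marginSelfWitness`, DISCHARGEABLE from the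
## landed breathing package (Literature `TameFamilyOffCompact` p128749, `TameBreathingCurve` p128932,
## `CauchyDevelopmentPrecomp` p129197: through every admissible datum passes a tame injective immersed
## admissible curve of ISOMETRIC COPIES, along which censored / quiet / margin transfer). 6 stubs ≤ 7.
##
## v1 → v2 → v3 (lead a1): stubs 2–3 RESHAPED TO CURVE FORM, END RE-CHOSEN (strictly weaker each
## time, same composition; landed: §1 = Literature/…/TameGenericityDiagonal.lean p127507 + p128027,
## reduction theorem = Theorems/PhaseMixingCaptureCaptureSufficesC2DiagonalReduction.lean p127810)

v3: the curve `F'` handed back by stubs 2–3 may be tame on ANY end `e'` (not necessarily the end `e`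
of the base curve): tame genericity asks for SOME end per exceptional datum, so the composition is
unchanged (`isTameChristodoulouGeneric_of_relative'`); the engine may re-centre / shrink the chart in
which `AFEnd.wDist` of its witness is measured. §8 records the LOGICAL POSITION of the reshaped stubs:
stub 2 ⟸ tame genericity of QUIET + quiet self-witnesses (a tame quiet curve through every quiet
datum — the breathing sub-case), and stub 1 ∧ stub 2 ⟹ tame genericity of QUIET; likewise for
stub 3 / MARGIN. So, up to self-witnesses, the line's layer 2 is {tame-generic QUIET, tame-generic
MARGIN (= item 10854 re-typed tame), all-accuracy drift capture (= item 10853 repaired + audit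
clauses)} — the foreseen split `QuietWindowApproach → NoExtremalParking → CaptureSufficesC2` of the
route header, with censorship entering as the source of base curves through non-censored data.

v2 (kept below): 
The v1 relative-witness stubs asked for a tame admissible TWO-parameter family `G` extending the
base curve `F` along the first axis (`G (c, 0) = F c`) with good DIAGONAL `c ↦ G (c, c)`. The
composition `isTameChristodoulouGeneric_of_relative` consumes ONLY the diagonal: a tame curve on the
same end through the base datum `F 0`, injective, immersed at `0`, admissible, with `P`-members off
`0`. v2 asks for exactly that curve `F'` (`TameCurveWitnessAlong`) and nothing else — the extension
clause `G ∘ axis = F` and tameness of the whole 2-family were unconsumed obligations. §7 proves the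
v1 forms imply the v2 forms (`F' := G ∘ diag`, `IsTameDataFamily.comp_contDiff`), so every triage
finding on v1 transfers; the engine may of course still BUILD `F'` as the diagonal of a kicked
2-family. §1 is generalized accordingly (parameter maps `φ` with `φ 0 = 0` instead of a `diag` def)
and proposed def-free to `Literature/Geometry/Lorentzian/TameGenericityDiagonal.lean` (p127507);
it stays inlined here until the farm snapshot builds that module. Stubs 1 and 4 are v1 verbatim.

## What changed under this line's feet (2026-08-16T21:18Z, BEFORE v1 was typed)

The summit `FinalStateConjecture` was RE-TYPED by the operator (semantic-vacuity audit §2.1, re-type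
T2, D-0032; Statement p126844): genericity is now TAME — `InitialDataSet.IsTameChristodoulouGeneric`
(`Literature/Geometry/Lorentzian/TameGenericity.lean`: ONE fixed end, jointly smooth, continuous ADM
mass, `AFEnd.wDist`-continuity and immersion at `c = 0`) — and the settling clause gained
`RaysStayInClosure` and `IsFutureOriented`. Consequences: the standing closure C⁺₀
(`captureSufficesC2_of_universalWitnessFamily`, SwallowTheDatum burial) is dead BY DESIGN; rank 5
`WeakCosmicCensorshipMGHD` is typed with the OLD `IsChristodoulouGeneric` and is UNUSABLE for a tame
conclusion — its tame successor is `stub_tameCensorship` (= rank 5 with `IsChristodoulouGeneric ↦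
IsTameChristodoulouGeneric`), the `hQ` of the composition. PLANNER NOTE for the tenure seat: restate
stmt-FinalStateConjecture-9952 (and 10164) to exactly `Goal.stub_tameCensorship`; then
`CaptureSufficesC2_of` consumes `hW` (`finalStateConjecture_of_tameRank5` is the rewiring).

## The line (4 registered stubs + the kernel-checked composition)

* `stub_tameCensorship` — TAME weak cosmic censorship (MGHD form): rank 5 restated. Hypothesis-grade.
* `stub_quietAlongCensoredCurves` (HARDEST) — curve form: through the base point of every tame
  admissible curve of CENSORED data (base arbitrary; curve immersed-injective or constant) passes a
  tame injective immersed admissible curve on the same end whose members off `0` are censored AND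
  adiabatically tracked at EVERY accuracy (complexity free per accuracy): kicked censored
  developments become QUIET — the Liouville / no-eternal-non-Kerr-dynamics content, along a kick
  parameter, never pointwise.
* `stub_marginAlongQuietCurves` — curve form, from QUIET curves to MARGIN members (one complexity
  `(N, m₀, χ < 1)` for all accuracies: no parking at extremality, a last merger, no evanescent holes).
* `stub_settlingKick` (v7; registered stub 4) — relative LOCAL settling kicks along MARGIN curves whose
  base does not settle; v1–v6's pointwise `stub_trackedCaptureSettles` — ALL-ACCURACY DRIFT CAPTURE
  (= 10853 repaired + the two audit clauses), over the landed `VacuumCauchyDevelopment.IsAdiabaticallyTracked` —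
  is kept as `Goal.stub_trackedCaptureSettles` and implies it (`settlingKick_of_trackedCaptureSettles`).
* `CaptureSufficesC2_of` — generic censored (stub 1) ⟹ generic quiet (§1 ∘ stub 2) ⟹ generic margin
  (§1 ∘ stub 3) ⟹ generic settling (§1 ∘ stub 4, v7; `mono` ∘ pointwise stub 4 in v1–v6) = the summit,
  hence the crux (its three hypotheses as typed are idle: ranks 2/4 by B2 p99273/p99879 + BN5 + BN7,
  rank 5 by the re-typing).
-/

set_option linter.dupNamespace false

noncomputable section

open scoped Manifold ContDiff Topology ENNReal
open Filter Set Function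

namespace Summit.FinalStateConjecture.FinalStateConjecture.Cruxes.CaptureSufficesC2.CensorshipEntersDiagonally

open Literature.Geometry.Lorentzian
open Summit.FinalStateConjecture (HasCompleteNullInfinity exteriorOf RaysStayInClosure HasExhaustiveCharts
  IsFutureOriented)
open Summit.FinalStateConjecture.FinalStateConjecture.Theses.PhaseMixingCapture
  (NearExtremalKappaCapture BulkKerrCaptureC2 WeakCosmicCensorshipMGHD CaptureSufficesC2)

/-! ## §1 Tame bookkeeping — LANDED as `Literature/Geometry/Lorentzian/TameGenericityDiagonal.lean`
(p127507 + p128027: `InitialDataSet.IsSmoothDataFamily.comp_contDiff`, `IsTameDataFamily.comp_contDiff`,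
`IsTameChristodoulouGeneric.mono`, `isTameChristodoulouGeneric_of_relative`, `…_of_relative'`); imported.
Only the line's vocabulary `TameCurveWitnessAlong` (a predicate, not landable in a proof file) stays here. -/

section Tame

variable {X : Type*} [TopologicalSpace X] [ChartedSpace E3 X] [IsManifold (𝓡 3) ∞ X]

/-- **TAME CURVE WITNESSES ALONG `Q`-CURVES** (v3: curve form of v1's `TameRelativeWitnessAlong`,
end re-chosen). For every end `e` and every TAME `𝓓`-curve `F` on `e` whose members off `0` satisfy
`Q` — `F` being TOLD to be either immersed at `0` and injective, or constant; the base datum `F 0`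
arbitrary — there are an end `e'` and a tame `𝓓`-curve `F'` on `e'` through the same base datum
(`F' 0 = F 0`), injective, immersed at `0`, with `P`-members off `0`. This is everything the
composition consumes; a kicked two-parameter family `G` with `G (c, 0) = F c` yields such an `F'` as
its diagonal (§7). -/
def TameCurveWitnessAlong (𝓓 : Set (InitialDataSet (𝓡 3) X))
    (Q P : InitialDataSet (𝓡 3) X → Prop) : Prop :=
  ∀ (e : AFEnd X) (F : EuclideanSpace ℝ (Fin 1) → InitialDataSet (𝓡 3) X),
    InitialDataSet.IsTameDataFamily e 1 F →
      ((InitialDataSet.IsImmersedAtZero 1 F ∧ Function.Injective F) ∨ ∀ c, F c = F 0) →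
        (∀ c, F c ∈ 𝓓) → (∀ c ≠ 0, Q (F c)) →
          ∃ (e' : AFEnd X) (F' : EuclideanSpace ℝ (Fin 1) → InitialDataSet (𝓡 3) X),
            InitialDataSet.IsTameDataFamily e' 1 F' ∧ F' 0 = F 0 ∧ Function.Injective F' ∧
              InitialDataSet.IsImmersedAtZero 1 F' ∧ (∀ c, F' c ∈ 𝓓) ∧ ∀ c ≠ 0, P (F' c)

/-- **COMPOSITION OF TAME CHRISTODOULOU GENERICITIES ALONG CURVES** (the landed
`InitialDataSet.isTameChristodoulouGeneric_of_relative'`, restated over the line's vocabulary). -/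
theorem isTameChristodoulouGeneric_of_relative {𝓓 : Set (InitialDataSet (𝓡 3) X)}
    {Q P : InitialDataSet (𝓡 3) X → Prop}
    (h𝓓 : ∀ d ∈ 𝓓, ∃ e : AFEnd X, e.IsSoleEnd ∧ ∃ M : ℝ, e.IsStronglyAsymptoticallyFlatDR d M)
    (hQ : InitialDataSet.IsTameChristodoulouGeneric 𝓓 Q 1) (hrel : TameCurveWitnessAlong 𝓓 Q P) :
    InitialDataSet.IsTameChristodoulouGeneric 𝓓 P 1 :=
  InitialDataSet.isTameChristodoulouGeneric_of_relative' h𝓓 hQ hrel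

/-- **Splitting curve witnesses by the base datum** (v4): curve witnesses along `Q`-curves follow
from the KICK case (base `F 0` without `P`; the curve `F` is the engine's input) and the
SELF-WITNESS case (base already has `P`: any tame injective immersed `𝓓`-curve of `P`-data through
it, e.g. a breathing curve of isometric copies). [folklore] -/
theorem tameCurveWitnessAlong_of_kick_and_self {𝓓 : Set (InitialDataSet (𝓡 3) X)}
    {Q P : InitialDataSet (𝓡 3) X → Prop}
    (hkick : ∀ (e : AFEnd X) (F : EuclideanSpace ℝ (Fin 1) → InitialDataSet (𝓡 3) X),
      InitialDataSet.IsTameDataFamily e 1 F →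
        ((InitialDataSet.IsImmersedAtZero 1 F ∧ Function.Injective F) ∨ ∀ c, F c = F 0) →
          (∀ c, F c ∈ 𝓓) → (∀ c ≠ 0, Q (F c)) → ¬ P (F 0) →
            ∃ (e' : AFEnd X) (F' : EuclideanSpace ℝ (Fin 1) → InitialDataSet (𝓡 3) X),
              InitialDataSet.IsTameDataFamily e' 1 F' ∧ F' 0 = F 0 ∧ Function.Injective F' ∧
                InitialDataSet.IsImmersedAtZero 1 F' ∧ (∀ c, F' c ∈ 𝓓) ∧ ∀ c ≠ 0, P (F' c))
    (hself : ∀ (e : AFEnd X) (d : InitialDataSet (𝓡 3) X),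
      InitialDataSet.IsTameDataFamily e 1 (fun _ : EuclideanSpace ℝ (Fin 1) ↦ d) → d ∈ 𝓓 → P d →
        ∃ (e' : AFEnd X) (F' : EuclideanSpace ℝ (Fin 1) → InitialDataSet (𝓡 3) X),
          InitialDataSet.IsTameDataFamily e' 1 F' ∧ F' 0 = d ∧ Function.Injective F' ∧
            InitialDataSet.IsImmersedAtZero 1 F' ∧ (∀ c, F' c ∈ 𝓓) ∧ ∀ c ≠ 0, P (F' c)) :
    TameCurveWitnessAlong 𝓓 Q P := by
  intro e F hF hdich h𝓓 hQ
  by_cases hP : P (F 0)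
  · obtain ⟨_, hsole, ⟨M, _, hSAF⟩, _⟩ := hF
    exact hself e (F 0) (InitialDataSet.isTameDataFamily_const hsole 1 (hSAF 0)) (h𝓓 0) hP
  · exact hkick e F hF hdich h𝓓 hQ hP

/-- **Splitting curve witnesses by the base datum, LOCAL kick** (v6): as
`tameCurveWitnessAlong_of_kick_and_self`, the kick case handing back a curve whose members have `P`
only for `0 < ‖c‖ < ε₀`; the landed `InitialDataSet.exists_tameCurve_of_local` (radial
reparametrisation, `TameGenericityLocal.lean`) makes it global. [folklore] -/
theorem tameCurveWitnessAlong_of_localKick_and_self {𝓓 : Set (InitialDataSet (𝓡 3) X)}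
    {Q P : InitialDataSet (𝓡 3) X → Prop}
    (hkick : ∀ (e : AFEnd X) (F : EuclideanSpace ℝ (Fin 1) → InitialDataSet (𝓡 3) X),
      InitialDataSet.IsTameDataFamily e 1 F →
        ((InitialDataSet.IsImmersedAtZero 1 F ∧ Function.Injective F) ∨ ∀ c, F c = F 0) →
          (∀ c, F c ∈ 𝓓) → (∀ c ≠ 0, Q (F c)) → ¬ P (F 0) →
            ∃ (e' : AFEnd X) (F' : EuclideanSpace ℝ (Fin 1) → InitialDataSet (𝓡 3) X),
              InitialDataSet.IsTameDataFamily e' 1 F' ∧ F' 0 = F 0 ∧ Function.Injective F' ∧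
                InitialDataSet.IsImmersedAtZero 1 F' ∧ (∀ c, F' c ∈ 𝓓) ∧
                  ∃ ε₀ > (0 : ℝ), ∀ c, c ≠ 0 → ‖c‖ < ε₀ → P (F' c))
    (hself : ∀ (e : AFEnd X) (d : InitialDataSet (𝓡 3) X),
      InitialDataSet.IsTameDataFamily e 1 (fun _ : EuclideanSpace ℝ (Fin 1) ↦ d) → d ∈ 𝓓 → P d →
        ∃ (e' : AFEnd X) (F' : EuclideanSpace ℝ (Fin 1) → InitialDataSet (𝓡 3) X),
          InitialDataSet.IsTameDataFamily e' 1 F' ∧ F' 0 = d ∧ Function.Injective F' ∧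
            InitialDataSet.IsImmersedAtZero 1 F' ∧ (∀ c, F' c ∈ 𝓓) ∧ ∀ c ≠ 0, P (F' c)) :
    TameCurveWitnessAlong 𝓓 Q P := by
  refine tameCurveWitnessAlong_of_kick_and_self (fun e F hF hdich h𝓓 hQ hP ↦ ?_) hself
  obtain ⟨e', F', hF', h0, hinj, himm, h𝓓', ε₀, hε₀, hP'⟩ := hkick e F hF hdich h𝓓 hQ hP
  exact InitialDataSet.exists_tameCurve_of_local hF' h0 hinj himm h𝓓' hε₀ hP'

end Tame

/-! ## §2 The properties iterated along the curves (matrices of the layer-2 statements) -/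

section Properties

variable {X : Type} [TopologicalSpace X] [ChartedSpace E3 X] [IsManifold (𝓡 3) ∞ X] [ConnectedSpace X]

/-- `Q₀` — the typed conclusion of weak cosmic censorship (MGHD form) at a datum: verbatim the
matrix of rank 5 `WeakCosmicCensorshipMGHD`. -/
def CensoredProperty (D : InitialDataSet (𝓡 3) X) : Prop :=
  (∃ 𝒟 : VacuumCauchyDevelopment D, 𝒟.IsMaximal) ∧
    ∀ 𝒟 : VacuumCauchyDevelopment D, 𝒟.IsMaximal → HasCompleteNullInfinity 𝒟.toCauchyDevelopment

/-- `Q₁` — QUIET: censored, and every MGHD is adiabatically tracked at EVERY accuracy `(ε, L, R₀)`,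
the complexity `(N, m₀, χ < 1)` being allowed to depend on the accuracy. -/
def QuietProperty (D : InitialDataSet (𝓡 3) X) : Prop :=
  CensoredProperty D ∧
    ∀ 𝒟 : VacuumCauchyDevelopment D, 𝒟.IsMaximal →
      ∀ (L : ℝ) (ε : ℝ≥0∞) (R₀ : ℝ), 0 < L → 0 < ε →
        ∃ (N : ℕ) (m₀ χ : ℝ), 0 < m₀ ∧ 0 ≤ χ ∧ χ < 1 ∧ 𝒟.IsAdiabaticallyTracked N m₀ χ ε L R₀

/-- `Q₂` — MARGIN: censored, and every MGHD is adiabatically tracked at every accuracy with ONE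
complexity `(N, m₀, χ < 1)`. -/
def MarginProperty (D : InitialDataSet (𝓡 3) X) : Prop :=
  CensoredProperty D ∧
    ∀ 𝒟 : VacuumCauchyDevelopment D, 𝒟.IsMaximal →
      ∃ (N : ℕ) (m₀ χ : ℝ), 0 < m₀ ∧ 0 ≤ χ ∧ χ < 1 ∧
        ∀ (L : ℝ) (ε : ℝ≥0∞) (R₀ : ℝ), 0 < L → 0 < ε → 𝒟.IsAdiabaticallyTracked N m₀ χ ε L R₀

/-- The settling clause of the RE-TYPED summit at one maximal development (verbatim). -/
def SettlingClause {D : InitialDataSet (𝓡 3) X} (𝒟 : VacuumCauchyDevelopment D) : Prop :=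
  ∃ (O : Set 𝒟.carrier) (d : FinalStateDecomposition 𝒟.toSpacetime O 2),
    (∀ i, Kerr.IsSubextremal (d.mass i) (d.spin i)) ∧
      O = exteriorOf 𝒟.toCauchyDevelopment d.charted ∧
        RaysStayInClosure 𝒟.toCauchyDevelopment O ∧ HasExhaustiveCharts d ∧ IsFutureOriented d

/-- `P` — the full typed conclusion of the re-typed summit at a datum (verbatim the matrix of
`FinalStateConjecture`, 2026-08-16T21:18Z). -/
def SummitProperty (D : InitialDataSet (𝓡 3) X) : Prop :=
  (∃ 𝒟 : VacuumCauchyDevelopment D, 𝒟.IsMaximal) ∧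
    ∀ 𝒟 : VacuumCauchyDevelopment D, 𝒟.IsMaximal →
      HasCompleteNullInfinity 𝒟.toCauchyDevelopment ∧
        ∃ (O : Set 𝒟.carrier) (d : FinalStateDecomposition 𝒟.toSpacetime O 2),
          (∀ i, Kerr.IsSubextremal (d.mass i) (d.spin i)) ∧
            O = exteriorOf 𝒟.toCauchyDevelopment d.charted ∧
              RaysStayInClosure 𝒟.toCauchyDevelopment O ∧ HasExhaustiveCharts d ∧ IsFutureOriented d

/-- `Q₂ ⊆ Q₁` (a uniform complexity serves every accuracy). [folklore] -/
theorem quiet_of_margin {D : InitialDataSet (𝓡 3) X} (h : MarginProperty D) : QuietProperty D := by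
  refine ⟨h.1, fun 𝒟 h𝒟 L ε R₀ hL hε ↦ ?_⟩
  obtain ⟨N, m₀, χ, hm₀, hχ₀, hχ₁, hT⟩ := h.2 𝒟 h𝒟
  exact ⟨N, m₀, χ, hm₀, hχ₀, hχ₁, hT L ε R₀ hL hε⟩

end Properties

/-! ## §3 Named statements of the stubs (short forms; the registered stubs below are their EXPANSIONS
over importable declarations, each definitionally the short form — `*_iff` by `Iff.rfl`) -/

/-- Short form of `stub_tameCensorship`: TAME weak cosmic censorship, MGHD form. -/
def TameCensorship : Prop :=
  ∀ (X : Type) [TopologicalSpace X] [ChartedSpace E3 X] [IsManifold (𝓡 3) ∞ X] [T2Space X]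
    [SecondCountableTopology X] [ConnectedSpace X],
    InitialDataSet.IsTameChristodoulouGeneric (admissibleVacuumData X) CensoredProperty 1

/-- Short form of `stub_quietAlongCensoredCurves` (v3, curve form, end re-chosen). -/
def QuietAlongCensoredCurves : Prop :=
  ∀ (X : Type) [TopologicalSpace X] [ChartedSpace E3 X] [IsManifold (𝓡 3) ∞ X] [T2Space X]
    [SecondCountableTopology X] [ConnectedSpace X],
    TameCurveWitnessAlong (admissibleVacuumData X) CensoredProperty QuietProperty

/-- Short form of `stub_marginAlongQuietCurves` (v3, curve form, end re-chosen). -/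
def MarginAlongQuietCurves : Prop :=
  ∀ (X : Type) [TopologicalSpace X] [ChartedSpace E3 X] [IsManifold (𝓡 3) ∞ X] [T2Space X]
    [SecondCountableTopology X] [ConnectedSpace X],
    TameCurveWitnessAlong (admissibleVacuumData X) QuietProperty MarginProperty

/-- Short form of `stub_quietKick` (v6, LOCAL): local curve witnesses of QUIET along censored curves whose
base is NOT quiet — the genuine content of stub 2. -/
def QuietKick : Prop :=
  ∀ (X : Type) [TopologicalSpace X] [ChartedSpace E3 X] [IsManifold (𝓡 3) ∞ X] [T2Space X]
    [SecondCountableTopology X] [ConnectedSpace X],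
    ∀ (e : AFEnd X) (F : EuclideanSpace ℝ (Fin 1) → InitialDataSet (𝓡 3) X),
      InitialDataSet.IsTameDataFamily e 1 F →
        ((InitialDataSet.IsImmersedAtZero 1 F ∧ Function.Injective F) ∨ ∀ c, F c = F 0) →
          (∀ c, F c ∈ admissibleVacuumData X) → (∀ c ≠ 0, CensoredProperty (F c)) →
            ¬ QuietProperty (F 0) →
              ∃ (e' : AFEnd X) (F' : EuclideanSpace ℝ (Fin 1) → InitialDataSet (𝓡 3) X),
                InitialDataSet.IsTameDataFamily e' 1 F' ∧ F' 0 = F 0 ∧ Function.Injective F' ∧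
                  InitialDataSet.IsImmersedAtZero 1 F' ∧ (∀ c, F' c ∈ admissibleVacuumData X) ∧
                    ∃ ε₀ > (0 : ℝ), ∀ c, c ≠ 0 → ‖c‖ < ε₀ → QuietProperty (F' c)

/-- Short form of `stub_quietSelfWitness` (v4): through every QUIET admissible datum a tame injective
immersed admissible curve of quiet data (dischargeable: breathing curve + transport). -/
def QuietSelfWitness : Prop :=
  ∀ (X : Type) [TopologicalSpace X] [ChartedSpace E3 X] [IsManifold (𝓡 3) ∞ X] [T2Space X]
    [SecondCountableTopology X] [ConnectedSpace X] (e : AFEnd X) (d : InitialDataSet (𝓡 3) X),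
    InitialDataSet.IsTameDataFamily e 1 (fun _ : EuclideanSpace ℝ (Fin 1) ↦ d) →
      d ∈ admissibleVacuumData X → QuietProperty d →
        ∃ (e' : AFEnd X) (F' : EuclideanSpace ℝ (Fin 1) → InitialDataSet (𝓡 3) X),
          InitialDataSet.IsTameDataFamily e' 1 F' ∧ F' 0 = d ∧ Function.Injective F' ∧
            InitialDataSet.IsImmersedAtZero 1 F' ∧ (∀ c, F' c ∈ admissibleVacuumData X) ∧
              ∀ c ≠ 0, QuietProperty (F' c)

/-- Short form of `stub_marginKick` (v6, LOCAL): local curve witnesses of MARGIN along quiet curves whose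
base has NO margin — the genuine content of stub 3. -/
def MarginKick : Prop :=
  ∀ (X : Type) [TopologicalSpace X] [ChartedSpace E3 X] [IsManifold (𝓡 3) ∞ X] [T2Space X]
    [SecondCountableTopology X] [ConnectedSpace X],
    ∀ (e : AFEnd X) (F : EuclideanSpace ℝ (Fin 1) → InitialDataSet (𝓡 3) X),
      InitialDataSet.IsTameDataFamily e 1 F →
        ((InitialDataSet.IsImmersedAtZero 1 F ∧ Function.Injective F) ∨ ∀ c, F c = F 0) →
          (∀ c, F c ∈ admissibleVacuumData X) → (∀ c ≠ 0, QuietProperty (F c)) →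
            ¬ MarginProperty (F 0) →
              ∃ (e' : AFEnd X) (F' : EuclideanSpace ℝ (Fin 1) → InitialDataSet (𝓡 3) X),
                InitialDataSet.IsTameDataFamily e' 1 F' ∧ F' 0 = F 0 ∧ Function.Injective F' ∧
                  InitialDataSet.IsImmersedAtZero 1 F' ∧ (∀ c, F' c ∈ admissibleVacuumData X) ∧
                    ∃ ε₀ > (0 : ℝ), ∀ c, c ≠ 0 → ‖c‖ < ε₀ → MarginProperty (F' c)

/-- Short form of `stub_marginSelfWitness` (v4): through every MARGIN admissible datum a tame injective
immersed admissible curve of margin data (dischargeable: breathing curve + transport). -/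
def MarginSelfWitness : Prop :=
  ∀ (X : Type) [TopologicalSpace X] [ChartedSpace E3 X] [IsManifold (𝓡 3) ∞ X] [T2Space X]
    [SecondCountableTopology X] [ConnectedSpace X] (e : AFEnd X) (d : InitialDataSet (𝓡 3) X),
    InitialDataSet.IsTameDataFamily e 1 (fun _ : EuclideanSpace ℝ (Fin 1) ↦ d) →
      d ∈ admissibleVacuumData X → MarginProperty d →
        ∃ (e' : AFEnd X) (F' : EuclideanSpace ℝ (Fin 1) → InitialDataSet (𝓡 3) X),
          InitialDataSet.IsTameDataFamily e' 1 F' ∧ F' 0 = d ∧ Function.Injective F' ∧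
            InitialDataSet.IsImmersedAtZero 1 F' ∧ (∀ c, F' c ∈ admissibleVacuumData X) ∧
              ∀ c ≠ 0, MarginProperty (F' c)

/-- Short form of `stub_trackedCaptureSettles`. -/
def TrackedCaptureSettles : Prop :=
  ∀ (X : Type) [TopologicalSpace X] [ChartedSpace E3 X] [IsManifold (𝓡 3) ∞ X] [T2Space X]
    [SecondCountableTopology X] [ConnectedSpace X],
    ∀ D ∈ admissibleVacuumData X, ∀ 𝒟 : VacuumCauchyDevelopment D, 𝒟.IsMaximal →
      HasCompleteNullInfinity 𝒟.toCauchyDevelopment →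
        (∃ (N : ℕ) (m₀ χ : ℝ), 0 < m₀ ∧ 0 ≤ χ ∧ χ < 1 ∧
          ∀ (L : ℝ) (ε : ℝ≥0∞) (R₀ : ℝ), 0 < L → 0 < ε → 𝒟.IsAdiabaticallyTracked N m₀ χ ε L R₀) →
          SettlingClause 𝒟

/-- Short form of `stub_settlingKick` (v7, relative + LOCAL): local curve witnesses of the full SUMMIT
property along MARGIN curves whose base does NOT have it — stub 4 in the shape of the two kick stubs. -/
def SettlingKick : Prop :=
  ∀ (X : Type) [TopologicalSpace X] [ChartedSpace E3 X] [IsManifold (𝓡 3) ∞ X] [T2Space X]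
    [SecondCountableTopology X] [ConnectedSpace X],
    ∀ (e : AFEnd X) (F : EuclideanSpace ℝ (Fin 1) → InitialDataSet (𝓡 3) X),
      InitialDataSet.IsTameDataFamily e 1 F →
        ((InitialDataSet.IsImmersedAtZero 1 F ∧ Function.Injective F) ∨ ∀ c, F c = F 0) →
          (∀ c, F c ∈ admissibleVacuumData X) → (∀ c ≠ 0, MarginProperty (F c)) →
            ¬ SummitProperty (F 0) →
              ∃ (e' : AFEnd X) (F' : EuclideanSpace ℝ (Fin 1) → InitialDataSet (𝓡 3) X),
                InitialDataSet.IsTameDataFamily e' 1 F' ∧ F' 0 = F 0 ∧ Function.Injective F' ∧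
                  InitialDataSet.IsImmersedAtZero 1 F' ∧ (∀ c, F' c ∈ admissibleVacuumData X) ∧
                    ∃ ε₀ > (0 : ℝ), ∀ c, c ≠ 0 → ‖c‖ < ε₀ → SummitProperty (F' c)

/-! ### Statements of the registered stubs, under the stub names -/
namespace Goal

/-- Statement of `stub_tameCensorship`. -/
abbrev stub_tameCensorship : Prop := TameCensorship
/-- Statement of `stub_quietAlongCensoredCurves`. -/
abbrev stub_quietAlongCensoredCurves : Prop := QuietAlongCensoredCurves
/-- Statement of `stub_marginAlongQuietCurves`. -/
abbrev stub_marginAlongQuietCurves : Prop := MarginAlongQuietCurves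
/-- Statement of `stub_trackedCaptureSettles`. -/
abbrev stub_trackedCaptureSettles : Prop := TrackedCaptureSettles
/-- Statement of `stub_quietKick` (v4). -/
abbrev stub_quietKick : Prop := QuietKick
/-- Statement of `stub_quietSelfWitness` (v4). -/
abbrev stub_quietSelfWitness : Prop := QuietSelfWitness
/-- Statement of `stub_marginKick` (v4). -/
abbrev stub_marginKick : Prop := MarginKick
/-- Statement of `stub_marginSelfWitness` (v4). -/
abbrev stub_marginSelfWitness : Prop := MarginSelfWitness
/-- Statement of `stub_settlingKick` (v7). -/
abbrev stub_settlingKick : Prop := SettlingKick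

end Goal

/-! ## §4 Registered stubs (the only `sorry`s of the file), stated EXPANDED over importable declarations
(`TameGenericity.lean`, `AdiabaticTracking.lean`, `Statement.lean`) so that `--supports` files can state
them verbatim without importing this Cruxes module. Each IS the short form of §3 definitionally. -/

/-- **Stub 1 `stub_tameCensorship` — TAME WEAK COSMIC CENSORSHIP (MGHD form).** For every connected
Hausdorff second-countable smooth `3`-manifold `X`, tame-Christodoulou-generically in
`admissibleVacuumData X`: a maximal vacuum Cauchy development exists and every MGHD has complete `𝓘⁺`
(sojourn form). Rank 5 `WeakCosmicCensorshipMGHD` with the summit's re-typed genericity — the expected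
owner RESTATEMENT of item stmt-FinalStateConjecture-9952; it STRENGTHENS rank 5
(`rank5_of_tameCensorship`). Hypothesis-grade; open-problem-sized as a theorem.
[cite: Christodoulou1999, p. A24] -/
theorem stub_tameCensorship :
    ∀ (X : Type) [TopologicalSpace X] [ChartedSpace E3 X] [IsManifold (𝓡 3) ∞ X] [T2Space X]
      [SecondCountableTopology X] [ConnectedSpace X],
      InitialDataSet.IsTameChristodoulouGeneric (admissibleVacuumData X)
        (fun D ↦ (∃ 𝒟 : VacuumCauchyDevelopment D, 𝒟.IsMaximal) ∧
          ∀ 𝒟 : VacuumCauchyDevelopment D, 𝒟.IsMaximal →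
            Summit.FinalStateConjecture.HasCompleteNullInfinity 𝒟.toCauchyDevelopment) 1 := by
  sorry

/-- **Stub 2a `stub_quietKick` (v6: LOCAL form; HARDEST) — SMALL KICKS OF CENSORED DEVELOPMENTS ARE QUIET,
along curves whose base is NOT quiet.** As stub 2, restricted to base data `F 0` failing QUIET, and
asked only of the members with `0 < ‖c‖ < ε₀` for some `ε₀ > 0` (tame genericity is local in the
parameter, `InitialDataSet.exists_tameCurve_of_local`): the genuine dynamical content (no eternal
non-Kerr vacuum dynamics along a generic small kick; decay of radiation through `𝓘⁺ ∪ 𝓗⁺`; rigidity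
of non-radiating exteriors), never claimed pointwise and never for large kicks.
[cite: DafermosLuk2017, §1.2.1 p. 8] [cite: Klainerman2025, §1.1.1] -/
theorem stub_quietKick :
    ∀ (X : Type) [TopologicalSpace X] [ChartedSpace E3 X] [IsManifold (𝓡 3) ∞ X] [T2Space X]
      [SecondCountableTopology X] [ConnectedSpace X],
      ∀ (e : AFEnd X) (F : EuclideanSpace ℝ (Fin 1) → InitialDataSet (𝓡 3) X),
        InitialDataSet.IsTameDataFamily e 1 F →
          ((InitialDataSet.IsImmersedAtZero 1 F ∧ Function.Injective F) ∨ ∀ c, F c = F 0) →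
          (∀ c, F c ∈ admissibleVacuumData X) →
          (∀ c ≠ 0, ((∃ 𝒟 : VacuumCauchyDevelopment (F c), 𝒟.IsMaximal) ∧
              ∀ 𝒟 : VacuumCauchyDevelopment (F c), 𝒟.IsMaximal →
                Summit.FinalStateConjecture.HasCompleteNullInfinity 𝒟.toCauchyDevelopment)) →
          ¬ (((∃ 𝒟 : VacuumCauchyDevelopment (F 0), 𝒟.IsMaximal) ∧
               ∀ 𝒟 : VacuumCauchyDevelopment (F 0), 𝒟.IsMaximal →
                 Summit.FinalStateConjecture.HasCompleteNullInfinity 𝒟.toCauchyDevelopment) ∧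
              ∀ 𝒟 : VacuumCauchyDevelopment (F 0), 𝒟.IsMaximal →
                ∀ (L : ℝ) (ε : ℝ≥0∞) (R₀ : ℝ), 0 < L → 0 < ε →
                  ∃ (N : ℕ) (m₀ χ : ℝ), 0 < m₀ ∧ 0 ≤ χ ∧ χ < 1 ∧
                    𝒟.IsAdiabaticallyTracked N m₀ χ ε L R₀) →
          ∃ (e' : AFEnd X) (F' : EuclideanSpace ℝ (Fin 1) → InitialDataSet (𝓡 3) X),
            InitialDataSet.IsTameDataFamily e' 1 F' ∧ F' 0 = F 0 ∧ Function.Injective F' ∧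
              InitialDataSet.IsImmersedAtZero 1 F' ∧ (∀ c, F' c ∈ admissibleVacuumData X) ∧
              ∃ ε₀ > (0 : ℝ), ∀ c : EuclideanSpace ℝ (Fin 1), c ≠ 0 → ‖c‖ < ε₀ →
                (((∃ 𝒟 : VacuumCauchyDevelopment (F' c), 𝒟.IsMaximal) ∧
                   ∀ 𝒟 : VacuumCauchyDevelopment (F' c), 𝒟.IsMaximal →
                     Summit.FinalStateConjecture.HasCompleteNullInfinity 𝒟.toCauchyDevelopment) ∧
                  ∀ 𝒟 : VacuumCauchyDevelopment (F' c), 𝒟.IsMaximal →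
                    ∀ (L : ℝ) (ε : ℝ≥0∞) (R₀ : ℝ), 0 < L → 0 < ε →
                      ∃ (N : ℕ) (m₀ χ : ℝ), 0 < m₀ ∧ 0 ≤ χ ∧ χ < 1 ∧
                        𝒟.IsAdiabaticallyTracked N m₀ χ ε L R₀) := by
  sorry

/-- **Stub 2b `stub_quietSelfWitness` (v5: DISCHARGED — no longer a stub) — through every QUIET admissible
datum passes a tame injective immersed admissible curve of QUIET data.** The landed theorem
`Theorems.PhaseMixingCaptureCaptureSufficesC2.stub_quietSelfWitness` (p129443): the breathing curve of `d`
(`Literature/Geometry/Lorentzian/TameBreathingCurve.lean`) along which censoredness and all-accuracy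
tracking transfer (`CauchyDevelopmentPrecomp.lean`). [cite: Christodoulou1999, p. A24] -/
theorem stub_quietSelfWitness :
    ∀ (X : Type) [TopologicalSpace X] [ChartedSpace E3 X] [IsManifold (𝓡 3) ∞ X] [T2Space X]
      [SecondCountableTopology X] [ConnectedSpace X] (e : AFEnd X) (d : InitialDataSet (𝓡 3) X),
      InitialDataSet.IsTameDataFamily e 1 (fun _ : EuclideanSpace ℝ (Fin 1) ↦ d) →
        d ∈ admissibleVacuumData X →
          (((∃ 𝒟 : VacuumCauchyDevelopment (d), 𝒟.IsMaximal) ∧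
             ∀ 𝒟 : VacuumCauchyDevelopment (d), 𝒟.IsMaximal →
               Summit.FinalStateConjecture.HasCompleteNullInfinity 𝒟.toCauchyDevelopment) ∧
            ∀ 𝒟 : VacuumCauchyDevelopment (d), 𝒟.IsMaximal →
              ∀ (L : ℝ) (ε : ℝ≥0∞) (R₀ : ℝ), 0 < L → 0 < ε →
                ∃ (N : ℕ) (m₀ χ : ℝ), 0 < m₀ ∧ 0 ≤ χ ∧ χ < 1 ∧
                  𝒟.IsAdiabaticallyTracked N m₀ χ ε L R₀) →
          ∃ (e' : AFEnd X) (F' : EuclideanSpace ℝ (Fin 1) → InitialDataSet (𝓡 3) X),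
            InitialDataSet.IsTameDataFamily e' 1 F' ∧ F' 0 = d ∧ Function.Injective F' ∧
              InitialDataSet.IsImmersedAtZero 1 F' ∧ (∀ c, F' c ∈ admissibleVacuumData X) ∧
              ∀ c : EuclideanSpace ℝ (Fin 1), c ≠ 0 →
                (((∃ 𝒟 : VacuumCauchyDevelopment (F' c), 𝒟.IsMaximal) ∧
                   ∀ 𝒟 : VacuumCauchyDevelopment (F' c), 𝒟.IsMaximal →
                     Summit.FinalStateConjecture.HasCompleteNullInfinity 𝒟.toCauchyDevelopment) ∧
                  ∀ 𝒟 : VacuumCauchyDevelopment (F' c), 𝒟.IsMaximal →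
                    ∀ (L : ℝ) (ε : ℝ≥0∞) (R₀ : ℝ), 0 < L → 0 < ε →
                      ∃ (N : ℕ) (m₀ χ : ℝ), 0 < m₀ ∧ 0 ≤ χ ∧ χ < 1 ∧
                        𝒟.IsAdiabaticallyTracked N m₀ χ ε L R₀) :=
  Summit.FinalStateConjecture.FinalStateConjecture.Theorems.PhaseMixingCaptureCaptureSufficesC2.stub_quietSelfWitness

/-- **Stub 3a `stub_marginKick` (v6: LOCAL form) — NO PARKING AT EXTREMALITY under small kicks along quiet
curves whose base has NO margin**: as stub 3, restricted to base data failing MARGIN and asked only of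
the members with `0 < ‖c‖ < ε₀` — third-law transversality in family form (Kehle–Unger,
Angelopoulos–Kehle–Unger), the genuine content.
[cite: KehleUnger2025] [cite: AngelopoulosKehleUnger2026, Thm 1] -/
theorem stub_marginKick :
    ∀ (X : Type) [TopologicalSpace X] [ChartedSpace E3 X] [IsManifold (𝓡 3) ∞ X] [T2Space X]
      [SecondCountableTopology X] [ConnectedSpace X],
      ∀ (e : AFEnd X) (F : EuclideanSpace ℝ (Fin 1) → InitialDataSet (𝓡 3) X),
        InitialDataSet.IsTameDataFamily e 1 F →
          ((InitialDataSet.IsImmersedAtZero 1 F ∧ Function.Injective F) ∨ ∀ c, F c = F 0) →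
          (∀ c, F c ∈ admissibleVacuumData X) →
          (∀ c ≠ 0,
            (((∃ 𝒟 : VacuumCauchyDevelopment (F c), 𝒟.IsMaximal) ∧
               ∀ 𝒟 : VacuumCauchyDevelopment (F c), 𝒟.IsMaximal →
                 Summit.FinalStateConjecture.HasCompleteNullInfinity 𝒟.toCauchyDevelopment) ∧
              ∀ 𝒟 : VacuumCauchyDevelopment (F c), 𝒟.IsMaximal →
                ∀ (L : ℝ) (ε : ℝ≥0∞) (R₀ : ℝ), 0 < L → 0 < ε →
                  ∃ (N : ℕ) (m₀ χ : ℝ), 0 < m₀ ∧ 0 ≤ χ ∧ χ < 1 ∧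
                    𝒟.IsAdiabaticallyTracked N m₀ χ ε L R₀)) →
          ¬ (((∃ 𝒟 : VacuumCauchyDevelopment (F 0), 𝒟.IsMaximal) ∧
               ∀ 𝒟 : VacuumCauchyDevelopment (F 0), 𝒟.IsMaximal →
                 Summit.FinalStateConjecture.HasCompleteNullInfinity 𝒟.toCauchyDevelopment) ∧
              ∀ 𝒟 : VacuumCauchyDevelopment (F 0), 𝒟.IsMaximal →
                ∃ (N : ℕ) (m₀ χ : ℝ), 0 < m₀ ∧ 0 ≤ χ ∧ χ < 1 ∧
                  ∀ (L : ℝ) (ε : ℝ≥0∞) (R₀ : ℝ), 0 < L → 0 < ε →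
                    𝒟.IsAdiabaticallyTracked N m₀ χ ε L R₀) →
          ∃ (e' : AFEnd X) (F' : EuclideanSpace ℝ (Fin 1) → InitialDataSet (𝓡 3) X),
            InitialDataSet.IsTameDataFamily e' 1 F' ∧ F' 0 = F 0 ∧ Function.Injective F' ∧
              InitialDataSet.IsImmersedAtZero 1 F' ∧ (∀ c, F' c ∈ admissibleVacuumData X) ∧
              ∃ ε₀ > (0 : ℝ), ∀ c : EuclideanSpace ℝ (Fin 1), c ≠ 0 → ‖c‖ < ε₀ →
                (((∃ 𝒟 : VacuumCauchyDevelopment (F' c), 𝒟.IsMaximal) ∧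
                   ∀ 𝒟 : VacuumCauchyDevelopment (F' c), 𝒟.IsMaximal →
                     Summit.FinalStateConjecture.HasCompleteNullInfinity 𝒟.toCauchyDevelopment) ∧
                  ∀ 𝒟 : VacuumCauchyDevelopment (F' c), 𝒟.IsMaximal →
                    ∃ (N : ℕ) (m₀ χ : ℝ), 0 < m₀ ∧ 0 ≤ χ ∧ χ < 1 ∧
                      ∀ (L : ℝ) (ε : ℝ≥0∞) (R₀ : ℝ), 0 < L → 0 < ε →
                        𝒟.IsAdiabaticallyTracked N m₀ χ ε L R₀) := by
  sorry

/-- **Stub 3b `stub_marginSelfWitness` (v5: DISCHARGED — no longer a stub) — through every MARGIN admissible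
datum passes a tame injective immersed admissible curve of MARGIN data.** The landed theorem
`Theorems.PhaseMixingCaptureCaptureSufficesC2.stub_marginSelfWitness` (p129443). [cite: Christodoulou1999, p. A24] -/
theorem stub_marginSelfWitness :
    ∀ (X : Type) [TopologicalSpace X] [ChartedSpace E3 X] [IsManifold (𝓡 3) ∞ X] [T2Space X]
      [SecondCountableTopology X] [ConnectedSpace X] (e : AFEnd X) (d : InitialDataSet (𝓡 3) X),
      InitialDataSet.IsTameDataFamily e 1 (fun _ : EuclideanSpace ℝ (Fin 1) ↦ d) →
        d ∈ admissibleVacuumData X →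
          (((∃ 𝒟 : VacuumCauchyDevelopment (d), 𝒟.IsMaximal) ∧
             ∀ 𝒟 : VacuumCauchyDevelopment (d), 𝒟.IsMaximal →
               Summit.FinalStateConjecture.HasCompleteNullInfinity 𝒟.toCauchyDevelopment) ∧
            ∀ 𝒟 : VacuumCauchyDevelopment (d), 𝒟.IsMaximal →
              ∃ (N : ℕ) (m₀ χ : ℝ), 0 < m₀ ∧ 0 ≤ χ ∧ χ < 1 ∧
                ∀ (L : ℝ) (ε : ℝ≥0∞) (R₀ : ℝ), 0 < L → 0 < ε →
                  𝒟.IsAdiabaticallyTracked N m₀ χ ε L R₀) →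
          ∃ (e' : AFEnd X) (F' : EuclideanSpace ℝ (Fin 1) → InitialDataSet (𝓡 3) X),
            InitialDataSet.IsTameDataFamily e' 1 F' ∧ F' 0 = d ∧ Function.Injective F' ∧
              InitialDataSet.IsImmersedAtZero 1 F' ∧ (∀ c, F' c ∈ admissibleVacuumData X) ∧
              ∀ c : EuclideanSpace ℝ (Fin 1), c ≠ 0 →
                (((∃ 𝒟 : VacuumCauchyDevelopment (F' c), 𝒟.IsMaximal) ∧
                   ∀ 𝒟 : VacuumCauchyDevelopment (F' c), 𝒟.IsMaximal →
                     Summit.FinalStateConjecture.HasCompleteNullInfinity 𝒟.toCauchyDevelopment) ∧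
                  ∀ 𝒟 : VacuumCauchyDevelopment (F' c), 𝒟.IsMaximal →
                    ∃ (N : ℕ) (m₀ χ : ℝ), 0 < m₀ ∧ 0 ≤ χ ∧ χ < 1 ∧
                      ∀ (L : ℝ) (ε : ℝ≥0∞) (R₀ : ℝ), 0 < L → 0 < ε →
                        𝒟.IsAdiabaticallyTracked N m₀ χ ε L R₀) :=
  Summit.FinalStateConjecture.FinalStateConjecture.Theorems.PhaseMixingCaptureCaptureSufficesC2.stub_marginSelfWitness

/-- **(v4: DERIVED from `stub_quietKick` + `stub_quietSelfWitness`, no longer a stub) Stub 2 `stub_quietAlongCensoredCurves` (HARDEST; v3 curve form, end re-chosen) — KICKED CENSORED DEVELOPMENTS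
BECOME QUIET, along curves.** For every `X`, every end `e` and every TAME admissible curve `F` on `e`
(told: immersed at `0` and injective, or constant) whose members off `0` are censored (an MGHD exists;
complete `𝓘⁺` in every MGHD; the base `F 0` arbitrary), there are an end `e'` and a tame admissible curve `F'` on
`e'` through the same base datum, injective and immersed at `0`, every member `F' c`, `c ≠ 0`, of which is
censored AND has each of its MGHDs adiabatically tracked at EVERY accuracy `(ε, L, R₀)` by chains of
`ε`-approximate sub-extremal multi-Kerr configurations (complexity free per accuracy). Content: the
ω-limit of a censored, generically kicked exterior lies in the Kerr moduli space (decay of radiation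
through `𝓘⁺ ∪ 𝓗⁺`, no eternal non-Kerr vacuum dynamics, rigidity of non-radiating exteriors) —
generic ALONG the kick parameter, never claimed pointwise; plus transversality (bad kick amplitudes
avoidable) and tameness of receding kicks (`wDist`-size `→ 0`); through a censored base datum
(constant case) it includes the existence of ONE tame immersed curve of quiet admissible data.
[cite: DafermosLuk2017, §1.2.1 p. 8] [cite: Klainerman2025, §1.1.1] -/
theorem stub_quietAlongCensoredCurves :
    ∀ (X : Type) [TopologicalSpace X] [ChartedSpace E3 X] [IsManifold (𝓡 3) ∞ X] [T2Space X]
      [SecondCountableTopology X] [ConnectedSpace X],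
      ∀ (e : AFEnd X) (F : EuclideanSpace ℝ (Fin 1) → InitialDataSet (𝓡 3) X),
        InitialDataSet.IsTameDataFamily e 1 F →
          ((InitialDataSet.IsImmersedAtZero 1 F ∧ Function.Injective F) ∨ ∀ c, F c = F 0) →
          (∀ c, F c ∈ admissibleVacuumData X) →
          (∀ c ≠ 0, (∃ 𝒟 : VacuumCauchyDevelopment (F c), 𝒟.IsMaximal) ∧
            ∀ 𝒟 : VacuumCauchyDevelopment (F c), 𝒟.IsMaximal →
              Summit.FinalStateConjecture.HasCompleteNullInfinity 𝒟.toCauchyDevelopment) →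
          ∃ (e' : AFEnd X) (F' : EuclideanSpace ℝ (Fin 1) → InitialDataSet (𝓡 3) X),
            InitialDataSet.IsTameDataFamily e' 1 F' ∧ F' 0 = F 0 ∧ Function.Injective F' ∧
              InitialDataSet.IsImmersedAtZero 1 F' ∧ (∀ c, F' c ∈ admissibleVacuumData X) ∧
              ∀ c : EuclideanSpace ℝ (Fin 1), c ≠ 0 →
                ((∃ 𝒟 : VacuumCauchyDevelopment (F' c), 𝒟.IsMaximal) ∧
                  ∀ 𝒟 : VacuumCauchyDevelopment (F' c), 𝒟.IsMaximal →
                    Summit.FinalStateConjecture.HasCompleteNullInfinity 𝒟.toCauchyDevelopment) ∧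
                ∀ 𝒟 : VacuumCauchyDevelopment (F' c), 𝒟.IsMaximal →
                  ∀ (L : ℝ) (ε : ℝ≥0∞) (R₀ : ℝ), 0 < L → 0 < ε →
                    ∃ (N : ℕ) (m₀ χ : ℝ), 0 < m₀ ∧ 0 ≤ χ ∧ χ < 1 ∧
                      𝒟.IsAdiabaticallyTracked N m₀ χ ε L R₀ := by
  intro X _ _ _ _ _ _
  exact tameCurveWitnessAlong_of_localKick_and_self (Q := CensoredProperty) (P := QuietProperty)
    (stub_quietKick X) (stub_quietSelfWitness X)

/-- **(v4: DERIVED from `stub_marginKick` + `stub_marginSelfWitness`, no longer a stub) Stub 3 `stub_marginAlongQuietCurves` (v3 curve form, end re-chosen) — NO PARKING AT EXTREMALITY (uniform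
margin), along curves.** For every `X`, every end `e` and every tame admissible curve `F` on `e` (told:
immersed-injective or constant) whose members off `0` are QUIET (censored and tracked at every
accuracy, complexity free), there are an end `e'` and a tame admissible curve `F'` on `e'` through the
same base datum,
injective and immersed at `0`, whose members off `0` are censored and tracked at every accuracy with
ONE complexity `(N, m₀, χ < 1)`: the kick moves the member off the threshold strata (extremal remnants
`χ ↑ 1`, vanishing holes `m₀ ↓ 0`, endless cascades) — third-law transversality in family form
(extremal horizons form only in positive codimension: Kehle–Unger, Angelopoulos–Kehle–Unger).
[cite: KehleUnger2025] [cite: AngelopoulosKehleUnger2026, Thm 1] -/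
theorem stub_marginAlongQuietCurves :
    ∀ (X : Type) [TopologicalSpace X] [ChartedSpace E3 X] [IsManifold (𝓡 3) ∞ X] [T2Space X]
      [SecondCountableTopology X] [ConnectedSpace X],
      ∀ (e : AFEnd X) (F : EuclideanSpace ℝ (Fin 1) → InitialDataSet (𝓡 3) X),
        InitialDataSet.IsTameDataFamily e 1 F →
          ((InitialDataSet.IsImmersedAtZero 1 F ∧ Function.Injective F) ∨ ∀ c, F c = F 0) →
          (∀ c, F c ∈ admissibleVacuumData X) →
          (∀ c ≠ 0,
            ((∃ 𝒟 : VacuumCauchyDevelopment (F c), 𝒟.IsMaximal) ∧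
              ∀ 𝒟 : VacuumCauchyDevelopment (F c), 𝒟.IsMaximal →
                Summit.FinalStateConjecture.HasCompleteNullInfinity 𝒟.toCauchyDevelopment) ∧
            ∀ 𝒟 : VacuumCauchyDevelopment (F c), 𝒟.IsMaximal →
              ∀ (L : ℝ) (ε : ℝ≥0∞) (R₀ : ℝ), 0 < L → 0 < ε →
                ∃ (N : ℕ) (m₀ χ : ℝ), 0 < m₀ ∧ 0 ≤ χ ∧ χ < 1 ∧
                  𝒟.IsAdiabaticallyTracked N m₀ χ ε L R₀) →
          ∃ (e' : AFEnd X) (F' : EuclideanSpace ℝ (Fin 1) → InitialDataSet (𝓡 3) X),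
            InitialDataSet.IsTameDataFamily e' 1 F' ∧ F' 0 = F 0 ∧ Function.Injective F' ∧
              InitialDataSet.IsImmersedAtZero 1 F' ∧ (∀ c, F' c ∈ admissibleVacuumData X) ∧
              ∀ c : EuclideanSpace ℝ (Fin 1), c ≠ 0 →
                ((∃ 𝒟 : VacuumCauchyDevelopment (F' c), 𝒟.IsMaximal) ∧
                  ∀ 𝒟 : VacuumCauchyDevelopment (F' c), 𝒟.IsMaximal →
                    Summit.FinalStateConjecture.HasCompleteNullInfinity 𝒟.toCauchyDevelopment) ∧
                ∀ 𝒟 : VacuumCauchyDevelopment (F' c), 𝒟.IsMaximal →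
                  ∃ (N : ℕ) (m₀ χ : ℝ), 0 < m₀ ∧ 0 ≤ χ ∧ χ < 1 ∧
                    ∀ (L : ℝ) (ε : ℝ≥0∞) (R₀ : ℝ), 0 < L → 0 < ε →
                      𝒟.IsAdiabaticallyTracked N m₀ χ ε L R₀ := by
  intro X _ _ _ _ _ _
  exact tameCurveWitnessAlong_of_localKick_and_self (Q := QuietProperty) (P := MarginProperty)
    (stub_marginKick X) (stub_marginSelfWitness X)

/-- **Stub 4 `stub_settlingKick` (v7: relative, LOCAL form) — SMALL KICKS OF MARGIN-TRACKED CENSORED DEVELOPMENTS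
SETTLE DOWN, along curves whose base does NOT settle.** For every `X`, every end `e` and every tame admissible curve
`F` on `e` (told: immersed-injective or constant) whose members off `0` have MARGIN (an MGHD exists; every MGHD has
complete `𝓘⁺` and is adiabatically tracked at every accuracy `(ε, L, R₀)` with ONE complexity `(N, m₀, χ < 1)`), the
base `F 0` NOT having the full per-datum property of the re-typed summit, there are an end `e'` and a tame admissible
curve `F'` on `e'` through `F 0`, injective and immersed at `0`, whose members with `0 < ‖c‖ < ε₀` have it: an MGHD
exists, and every MGHD has complete `𝓘⁺` and a `C²` `FinalStateDecomposition` with sub-extremal holes of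
`O = exteriorOf`, rays from the data staying in `closure O`, exhaustive and future-oriented charts. Content: orbital
proximity to the sub-extremal Kerr MODULI SPACE window by window, with margin, becomes asymptotic convergence after
a generic small kick (first-law drift budget, re-anchoring across windows, receding assembly, pinned exhaustion) —
all-accuracy drift capture in the summit's own window vocabulary, asked along a kick parameter, never pointwise.
The pointwise form (= item stmt-FinalStateConjecture-10853 repaired + the audit clauses, v1–v6 `stub_trackedCaptureSettles`)
implies it (`settlingKick_of_trackedCaptureSettles`). [cite: KlainermanSzeftel2023, Thm 1.1] [cite: Klainerman2025, §2.3] -/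
theorem stub_settlingKick :
    ∀ (X : Type) [TopologicalSpace X] [ChartedSpace E3 X] [IsManifold (𝓡 3) ∞ X] [T2Space X]
      [SecondCountableTopology X] [ConnectedSpace X],
      ∀ (e : AFEnd X) (F : EuclideanSpace ℝ (Fin 1) → InitialDataSet (𝓡 3) X),
        InitialDataSet.IsTameDataFamily e 1 F →
          ((InitialDataSet.IsImmersedAtZero 1 F ∧ Function.Injective F) ∨ ∀ c, F c = F 0) →
          (∀ c, F c ∈ admissibleVacuumData X) →
          (∀ c ≠ 0, (((∃ 𝒟 : VacuumCauchyDevelopment (F c), 𝒟.IsMaximal) ∧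
              ∀ 𝒟 : VacuumCauchyDevelopment (F c), 𝒟.IsMaximal →
                Summit.FinalStateConjecture.HasCompleteNullInfinity 𝒟.toCauchyDevelopment) ∧
            ∀ 𝒟 : VacuumCauchyDevelopment (F c), 𝒟.IsMaximal →
              ∃ (N : ℕ) (m₀ χ : ℝ), 0 < m₀ ∧ 0 ≤ χ ∧ χ < 1 ∧
                ∀ (L : ℝ) (ε : ℝ≥0∞) (R₀ : ℝ), 0 < L → 0 < ε →
                  𝒟.IsAdiabaticallyTracked N m₀ χ ε L R₀)) →
          ¬ ((∃ 𝒟 : VacuumCauchyDevelopment (F 0), 𝒟.IsMaximal) ∧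
            ∀ 𝒟 : VacuumCauchyDevelopment (F 0), 𝒟.IsMaximal →
              Summit.FinalStateConjecture.HasCompleteNullInfinity 𝒟.toCauchyDevelopment ∧
                ∃ (O : Set 𝒟.carrier) (dd : FinalStateDecomposition 𝒟.toSpacetime O 2),
                  (∀ i, Kerr.IsSubextremal (dd.mass i) (dd.spin i)) ∧
                    O = Summit.FinalStateConjecture.exteriorOf 𝒟.toCauchyDevelopment dd.charted ∧
                      Summit.FinalStateConjecture.RaysStayInClosure 𝒟.toCauchyDevelopment O ∧
                        Summit.FinalStateConjecture.HasExhaustiveCharts dd ∧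
                          Summit.FinalStateConjecture.IsFutureOriented dd) →
          ∃ (e' : AFEnd X) (F' : EuclideanSpace ℝ (Fin 1) → InitialDataSet (𝓡 3) X),
            InitialDataSet.IsTameDataFamily e' 1 F' ∧ F' 0 = F 0 ∧ Function.Injective F' ∧
              InitialDataSet.IsImmersedAtZero 1 F' ∧ (∀ c, F' c ∈ admissibleVacuumData X) ∧
              ∃ ε₀ > (0 : ℝ), ∀ c : EuclideanSpace ℝ (Fin 1), c ≠ 0 → ‖c‖ < ε₀ →
                ((∃ 𝒟 : VacuumCauchyDevelopment (F' c), 𝒟.IsMaximal) ∧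
                  ∀ 𝒟 : VacuumCauchyDevelopment (F' c), 𝒟.IsMaximal →
                    Summit.FinalStateConjecture.HasCompleteNullInfinity 𝒟.toCauchyDevelopment ∧
                      ∃ (O : Set 𝒟.carrier) (dd : FinalStateDecomposition 𝒟.toSpacetime O 2),
                        (∀ i, Kerr.IsSubextremal (dd.mass i) (dd.spin i)) ∧
                          O = Summit.FinalStateConjecture.exteriorOf 𝒟.toCauchyDevelopment dd.charted ∧
                            Summit.FinalStateConjecture.RaysStayInClosure 𝒟.toCauchyDevelopment O ∧
                              Summit.FinalStateConjecture.HasExhaustiveCharts dd ∧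
                                Summit.FinalStateConjecture.IsFutureOriented dd) := by
  sorry

/-! ### The registered stubs ARE the short forms (definitional checks) -/

theorem stub_tameCensorship_iff : Goal.stub_tameCensorship ↔
    ∀ (X : Type) [TopologicalSpace X] [ChartedSpace E3 X] [IsManifold (𝓡 3) ∞ X] [T2Space X]
      [SecondCountableTopology X] [ConnectedSpace X],
      InitialDataSet.IsTameChristodoulouGeneric (admissibleVacuumData X)
        (fun D ↦ (∃ 𝒟 : VacuumCauchyDevelopment D, 𝒟.IsMaximal) ∧
          ∀ 𝒟 : VacuumCauchyDevelopment D, 𝒟.IsMaximal →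
            Summit.FinalStateConjecture.HasCompleteNullInfinity 𝒟.toCauchyDevelopment) 1 :=
  Iff.rfl

theorem tameCensorship_holds : Goal.stub_tameCensorship := stub_tameCensorship
theorem quietAlongCensoredCurves_holds : Goal.stub_quietAlongCensoredCurves := stub_quietAlongCensoredCurves
theorem marginAlongQuietCurves_holds : Goal.stub_marginAlongQuietCurves := stub_marginAlongQuietCurves
theorem quietKick_holds : Goal.stub_quietKick := stub_quietKick
theorem quietSelfWitness_holds : Goal.stub_quietSelfWitness := stub_quietSelfWitness
theorem marginKick_holds : Goal.stub_marginKick := stub_marginKick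
theorem marginSelfWitness_holds : Goal.stub_marginSelfWitness := stub_marginSelfWitness
theorem settlingKick_holds : Goal.stub_settlingKick := stub_settlingKick

/-! ## §5 The composition (sorry-free): the summit, hence the crux BY NAME -/

/-- **THE COMPOSITION OF v7 (exactly the four registered stubs).** Tame-generic censorship (stub 1) ⟹
tame-generic QUIET (composition lemma ∘ curve witnesses = local quiet KICK + landed quiet self-witnesses) ⟹
tame-generic MARGIN (likewise with the margin KICK) ⟹ the re-typed summit, by a THIRD application of the
composition lemma with the curve witnesses of the SUMMIT property = local settling KICK (stub 4) + the landed
summit self-witnesses (`finalStateConjecture_of_genericMargin_of_settlingKick`, p130476). -/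
theorem finalStateConjecture_of_kicks (h₅ : Goal.stub_tameCensorship) (h₁k : Goal.stub_quietKick)
    (h₂k : Goal.stub_marginKick) (h₄ : Goal.stub_settlingKick) : _root_.FinalStateConjecture := by
  refine Summit.FinalStateConjecture.FinalStateConjecture.Theorems.PhaseMixingCaptureCaptureSufficesC2.finalStateConjecture_of_genericMargin_of_settlingKick
    (fun X _ _ _ _ _ _ ↦ ?_) h₄
  have h𝓓 : ∀ d ∈ admissibleVacuumData X,
      ∃ e : AFEnd X, e.IsSoleEnd ∧ ∃ M : ℝ, e.IsStronglyAsymptoticallyFlatDR d M :=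
    fun d hd ↦ exists_isSoleEnd_of_mem_admissibleVacuumData hd
  have gQ : InitialDataSet.IsTameChristodoulouGeneric (admissibleVacuumData X) QuietProperty 1 :=
    isTameChristodoulouGeneric_of_relative h𝓓 (h₅ X)
      (tameCurveWitnessAlong_of_localKick_and_self (h₁k X)
        (Summit.FinalStateConjecture.FinalStateConjecture.Theorems.PhaseMixingCaptureCaptureSufficesC2.stub_quietSelfWitness X))
  have gM : InitialDataSet.IsTameChristodoulouGeneric (admissibleVacuumData X) MarginProperty 1 :=
    isTameChristodoulouGeneric_of_relative h𝓓 gQ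
      (tameCurveWitnessAlong_of_localKick_and_self (h₂k X)
        (Summit.FinalStateConjecture.FinalStateConjecture.Theorems.PhaseMixingCaptureCaptureSufficesC2.stub_marginSelfWitness X))
  exact gM

/-- **THE CRUX BY NAME (v7: exactly the four registered stubs).** Tame censorship; QUIET kick; MARGIN kick;
SETTLING kick ⟹ `CaptureSufficesC2` — the three self-witness halves are discharged INSIDE the proof by the landed
theorems (p129443, p130476); the crux's own three hypotheses are idle as typed (ranks 2/4: B2; rank 5: topology-free
genericity, consumed only in its tame form `h₅`). -/
theorem CaptureSufficesC2_of :
    Goal.stub_tameCensorship → Goal.stub_quietKick → Goal.stub_marginKick → Goal.stub_settlingKick →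
      Summit.FinalStateConjecture.FinalStateConjecture.Theses.PhaseMixingCapture.CaptureSufficesC2 := by
  intro h₅ h₁k h₂k h₄ _hNear _hBulk _hWCC
  exact finalStateConjecture_of_kicks h₅ h₁k h₂k h₄

/-- **Layer 2, assembled along curves (v3–v6 composition, kept: the pointwise stub 4 as last arrow).**
Tame-generic censorship (stub 1) ⟹ tame-generic QUIET (composition lemma with the curve witnesses of
stub 2) ⟹ tame-generic MARGIN (composition lemma with stub 3) ⟹ tame-generic SETTLING (pointwise upgrade
by the all-accuracy drift capture `Goal.stub_trackedCaptureSettles`, `mono`) = the re-typed summit. -/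
theorem finalStateConjecture_of_stubs (h₅ : Goal.stub_tameCensorship)
    (h₁ : Goal.stub_quietAlongCensoredCurves) (h₂ : Goal.stub_marginAlongQuietCurves)
    (h₃ : Goal.stub_trackedCaptureSettles) : _root_.FinalStateConjecture := by
  intro X _ _ _ _ _ _
  have h𝓓 : ∀ d ∈ admissibleVacuumData X,
      ∃ e : AFEnd X, e.IsSoleEnd ∧ ∃ M : ℝ, e.IsStronglyAsymptoticallyFlatDR d M :=
    fun d hd ↦ exists_isSoleEnd_of_mem_admissibleVacuumData hd
  have gQ : InitialDataSet.IsTameChristodoulouGeneric (admissibleVacuumData X) QuietProperty 1 :=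
    isTameChristodoulouGeneric_of_relative h𝓓 (h₅ X) (h₁ X)
  have gM : InitialDataSet.IsTameChristodoulouGeneric (admissibleVacuumData X) MarginProperty 1 :=
    isTameChristodoulouGeneric_of_relative h𝓓 gQ (h₂ X)
  have gP : InitialDataSet.IsTameChristodoulouGeneric (admissibleVacuumData X) SummitProperty 1 :=
    InitialDataSet.IsTameChristodoulouGeneric.mono gM fun D hD hM ↦
      ⟨hM.1.1, fun 𝒟 h𝒟 ↦ ⟨hM.1.2 𝒟 h𝒟, h₃ X D hD 𝒟 h𝒟 (hM.1.2 𝒟 h𝒟) (hM.2 𝒟 h𝒟)⟩⟩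
  exact gP

/-- Stub 2 from its two v4 halves. -/
theorem quietAlongCensoredCurves_of_kick_and_self (hk : Goal.stub_quietKick)
    (hs : Goal.stub_quietSelfWitness) : Goal.stub_quietAlongCensoredCurves := by
  intro X _ _ _ _ _ _
  exact tameCurveWitnessAlong_of_localKick_and_self (hk X) (hs X)

/-- Stub 3 from its two v4 halves. -/
theorem marginAlongQuietCurves_of_kick_and_self (hk : Goal.stub_marginKick)
    (hs : Goal.stub_marginSelfWitness) : Goal.stub_marginAlongQuietCurves := by
  intro X _ _ _ _ _ _
  exact tameCurveWitnessAlong_of_localKick_and_self (hk X) (hs X)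

/-- **The v5/v6 composition (kept: pointwise stub 4).** Tame censorship; QUIET kick; MARGIN
kick; all-accuracy drift capture ⟹ `CaptureSufficesC2` — the two self-witness halves of stubs 2–3 are
discharged INSIDE the proof by the landed theorems (p129443); the crux's own three hypotheses are idle
as typed. -/
theorem CaptureSufficesC2_of_pointwise :
    Goal.stub_tameCensorship → Goal.stub_quietKick → Goal.stub_marginKick → Goal.stub_trackedCaptureSettles →
      Summit.FinalStateConjecture.FinalStateConjecture.Theses.PhaseMixingCapture.CaptureSufficesC2 := by
  intro h₅ h₁k h₂k h₃ _hNear _hBulk _hWCC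
  exact finalStateConjecture_of_stubs h₅
    (quietAlongCensoredCurves_of_kick_and_self h₁k
      Summit.FinalStateConjecture.FinalStateConjecture.Theorems.PhaseMixingCaptureCaptureSufficesC2.stub_quietSelfWitness)
    (marginAlongQuietCurves_of_kick_and_self h₂k
      Summit.FinalStateConjecture.FinalStateConjecture.Theorems.PhaseMixingCaptureCaptureSufficesC2.stub_marginSelfWitness)
    h₃

/-- The v4 six-hypothesis composition (kept for the record: kick + self-witness halves explicit). -/
theorem CaptureSufficesC2_of_six :
    Goal.stub_tameCensorship → Goal.stub_quietKick → Goal.stub_quietSelfWitness →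
      Goal.stub_marginKick → Goal.stub_marginSelfWitness → Goal.stub_trackedCaptureSettles →
        Summit.FinalStateConjecture.FinalStateConjecture.Theses.PhaseMixingCapture.CaptureSufficesC2 := by
  intro h₅ h₁k h₁s h₂k h₂s h₃ _hNear _hBulk _hWCC
  exact finalStateConjecture_of_stubs h₅ (quietAlongCensoredCurves_of_kick_and_self h₁k h₁s)
    (marginAlongQuietCurves_of_kick_and_self h₂k h₂s) h₃

/-- The v3 four-stub composition (kept: `--supports` glue `captureSufficesC2_of_tameLayer`, p127810). -/
theorem CaptureSufficesC2_of_four :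
    Goal.stub_tameCensorship → Goal.stub_quietAlongCensoredCurves → Goal.stub_marginAlongQuietCurves →
      Goal.stub_trackedCaptureSettles →
        Summit.FinalStateConjecture.FinalStateConjecture.Theses.PhaseMixingCapture.CaptureSufficesC2 := by
  intro h₅ h₁ h₂ h₃ _hNear _hBulk _hWCC
  exact finalStateConjecture_of_stubs h₅ h₁ h₂ h₃

/-! ## §6 Sanity links (sorry-free) -/

/-- Stub 1 STRENGTHENS rank 5 as typed (tame ⇒ topology-free genericity). -/
theorem rank5_of_tameCensorship (h : Goal.stub_tameCensorship) : WeakCosmicCensorshipMGHD := by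
  intro X _ _ _ _ _ _
  exact (h X).isChristodoulouGeneric

/-- The one-line REWIRING for the day rank 5 is restated tame (its body becomes `Goal.stub_tameCensorship`
verbatim): the composition then consumes the crux's third hypothesis and stub 1 disappears. -/
theorem finalStateConjecture_of_tameRank5 (hW : Goal.stub_tameCensorship)
    (h₁k : Goal.stub_quietKick) (h₂k : Goal.stub_marginKick) (h₄ : Goal.stub_settlingKick) :
    NearExtremalKappaCapture → BulkKerrCaptureC2 → _root_.FinalStateConjecture :=
  fun _ _ ↦ finalStateConjecture_of_kicks hW h₁k h₂k h₄

/-- **The crux with its third hypothesis CONSUMED.** If stub 1 is traded for the UPGRADE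
`WeakCosmicCensorshipMGHD → Goal.stub_tameCensorship` (rank 5 as typed ⟹ rank 5 tame; implied by
stub 1, hypothesis-grade like it — taming a topology-free censored witness curve is not cheaper than
producing a tame one), the composition consumes `hWCC`. This is the alternative to the owner
restatement of stmt-9952: keep rank 5 as typed and register the upgrade as the line's first stub. -/
theorem CaptureSufficesC2_of_upgrade
    (hup : WeakCosmicCensorshipMGHD → Goal.stub_tameCensorship) (h₁k : Goal.stub_quietKick)
    (h₂k : Goal.stub_marginKick) (h₄ : Goal.stub_settlingKick) :
    Summit.FinalStateConjecture.FinalStateConjecture.Theses.PhaseMixingCapture.CaptureSufficesC2 :=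
  fun hNear hBulk hWCC ↦ CaptureSufficesC2_of (hup hWCC) h₁k h₂k h₄ hNear hBulk hWCC

/-- Stub 1 gives the upgrade (ignore the hypothesis). -/
theorem upgrade_of_tameCensorship (h : Goal.stub_tameCensorship) :
    WeakCosmicCensorshipMGHD → Goal.stub_tameCensorship := fun _ ↦ h

/-- The summit implies stub 1 (tame genericity is monotone): stub 1 is NECESSARY, as rank 5 was. -/
theorem tameCensorship_of_finalStateConjecture (h : _root_.FinalStateConjecture) : Goal.stub_tameCensorship := by
  intro X _ _ _ _ _ _
  exact InitialDataSet.IsTameChristodoulouGeneric.mono (h X) fun D _ hP ↦ ⟨hP.1, fun 𝒟 h𝒟 ↦ (hP.2 𝒟 h𝒟).1⟩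

/-- **v5 ⟹ v6 for stub 2a**: the global kick form (quiet members at every `c ≠ 0`) implies the
registered LOCAL form (take `ε₀ := 1`). The reshape v5 → v6 is a weakening. [folklore] -/
theorem quietKick_of_global
    (h : ∀ (X : Type) [TopologicalSpace X] [ChartedSpace E3 X] [IsManifold (𝓡 3) ∞ X] [T2Space X]
      [SecondCountableTopology X] [ConnectedSpace X],
      ∀ (e : AFEnd X) (F : EuclideanSpace ℝ (Fin 1) → InitialDataSet (𝓡 3) X),
        InitialDataSet.IsTameDataFamily e 1 F →
          ((InitialDataSet.IsImmersedAtZero 1 F ∧ Function.Injective F) ∨ ∀ c, F c = F 0) →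
            (∀ c, F c ∈ admissibleVacuumData X) → (∀ c ≠ 0, CensoredProperty (F c)) →
              ¬ QuietProperty (F 0) →
                ∃ (e' : AFEnd X) (F' : EuclideanSpace ℝ (Fin 1) → InitialDataSet (𝓡 3) X),
                  InitialDataSet.IsTameDataFamily e' 1 F' ∧ F' 0 = F 0 ∧ Function.Injective F' ∧
                    InitialDataSet.IsImmersedAtZero 1 F' ∧ (∀ c, F' c ∈ admissibleVacuumData X) ∧
                      ∀ c ≠ 0, QuietProperty (F' c)) :
    Goal.stub_quietKick := by
  intro X _ _ _ _ _ _ e F hF hdich h𝓓 hQ hP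
  obtain ⟨e', F', hF', h0, hinj, himm, h𝓓', hP'⟩ := h X e F hF hdich h𝓓 hQ hP
  exact ⟨e', F', hF', h0, hinj, himm, h𝓓', 1, one_pos, fun c hc _ ↦ hP' c hc⟩

/-- **v5 ⟹ v6 for stub 3a** (take `ε₀ := 1`). [folklore] -/
theorem marginKick_of_global
    (h : ∀ (X : Type) [TopologicalSpace X] [ChartedSpace E3 X] [IsManifold (𝓡 3) ∞ X] [T2Space X]
      [SecondCountableTopology X] [ConnectedSpace X],
      ∀ (e : AFEnd X) (F : EuclideanSpace ℝ (Fin 1) → InitialDataSet (𝓡 3) X),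
        InitialDataSet.IsTameDataFamily e 1 F →
          ((InitialDataSet.IsImmersedAtZero 1 F ∧ Function.Injective F) ∨ ∀ c, F c = F 0) →
            (∀ c, F c ∈ admissibleVacuumData X) → (∀ c ≠ 0, QuietProperty (F c)) →
              ¬ MarginProperty (F 0) →
                ∃ (e' : AFEnd X) (F' : EuclideanSpace ℝ (Fin 1) → InitialDataSet (𝓡 3) X),
                  InitialDataSet.IsTameDataFamily e' 1 F' ∧ F' 0 = F 0 ∧ Function.Injective F' ∧
                    InitialDataSet.IsImmersedAtZero 1 F' ∧ (∀ c, F' c ∈ admissibleVacuumData X) ∧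
                      ∀ c ≠ 0, MarginProperty (F' c)) :
    Goal.stub_marginKick := by
  intro X _ _ _ _ _ _ e F hF hdich h𝓓 hQ hP
  obtain ⟨e', F', hF', h0, hinj, himm, h𝓓', hP'⟩ := h X e F hF hdich h𝓓 hQ hP
  exact ⟨e', F', hF', h0, hinj, himm, h𝓓', 1, one_pos, fun c hc _ ↦ hP' c hc⟩

/-- **v6 ⟹ v5**: conversely the LOCAL kick stubs give back the global curve witnesses (the landed
radial reparametrisation), so v5 and v6 are equivalent stub sets; v6 registers the weaker-looking
member of each pair. [folklore] -/
theorem quietKick_global_of_local (h : Goal.stub_quietKick) (X : Type) [TopologicalSpace X]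
    [ChartedSpace E3 X] [IsManifold (𝓡 3) ∞ X] [T2Space X] [SecondCountableTopology X]
    [ConnectedSpace X] (e : AFEnd X) (F : EuclideanSpace ℝ (Fin 1) → InitialDataSet (𝓡 3) X)
    (hF : InitialDataSet.IsTameDataFamily e 1 F)
    (hdich : (InitialDataSet.IsImmersedAtZero 1 F ∧ Function.Injective F) ∨ ∀ c, F c = F 0)
    (h𝓓 : ∀ c, F c ∈ admissibleVacuumData X) (hQ : ∀ c ≠ 0, CensoredProperty (F c))
    (hP : ¬ QuietProperty (F 0)) :
    ∃ (e' : AFEnd X) (F' : EuclideanSpace ℝ (Fin 1) → InitialDataSet (𝓡 3) X),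
      InitialDataSet.IsTameDataFamily e' 1 F' ∧ F' 0 = F 0 ∧ Function.Injective F' ∧
        InitialDataSet.IsImmersedAtZero 1 F' ∧ (∀ c, F' c ∈ admissibleVacuumData X) ∧
          ∀ c ≠ 0, QuietProperty (F' c) := by
  obtain ⟨e', F', hF', h0, hinj, himm, h𝓓', ε₀, hε₀, hP'⟩ := h X e F hF hdich h𝓓 hQ hP
  exact InitialDataSet.exists_tameCurve_of_local hF' h0 hinj himm h𝓓' hε₀ hP'

/-- Margin data settle (pointwise, granted stub 4): the last arrow of the chain is a plain `mono`. -/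
theorem summitProperty_of_margin (h₃ : Goal.stub_trackedCaptureSettles) {X : Type} [TopologicalSpace X]
    [ChartedSpace E3 X] [IsManifold (𝓡 3) ∞ X] [T2Space X] [SecondCountableTopology X] [ConnectedSpace X]
    {D : InitialDataSet (𝓡 3) X} (hD : D ∈ admissibleVacuumData X) (hM : MarginProperty D) :
    SummitProperty D :=
  ⟨hM.1.1, fun 𝒟 h𝒟 ↦ ⟨hM.1.2 𝒟 h𝒟, h₃ X D hD 𝒟 h𝒟 (hM.1.2 𝒟 h𝒟) (hM.2 𝒟 h𝒟)⟩⟩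

/-- **v6 ⟹ v7 for stub 4: the pointwise all-accuracy drift capture gives the relative local settling kick**
(take `F' := F` on an immersed-injective margin curve — its members off `0` settle pointwise —; on a constant
margin curve the base itself is margin, hence settles pointwise, contradicting the kick hypothesis). So the
reshape v6 → v7 is a weakening, and a restated item stmt-FinalStateConjecture-10853 (:= `Goal.stub_trackedCaptureSettles`)
still discharges stub 4 in one line. [folklore] -/
theorem settlingKick_of_trackedCaptureSettles (h₃ : Goal.stub_trackedCaptureSettles) : Goal.stub_settlingKick := by
  intro X _ _ _ _ _ _ e F hF hdich h𝓓 hQ hP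
  have hc₁ : (EuclideanSpace.single (0 : Fin 1) (1 : ℝ) : EuclideanSpace ℝ (Fin 1)) ≠ 0 := by
    intro h
    have := congrArg (fun v : EuclideanSpace ℝ (Fin 1) ↦ v 0) h
    simp at this
  rcases hdich with ⟨himm, hinj⟩ | hconst
  · exact ⟨e, F, hF, rfl, hinj, himm, h𝓓, 1, one_pos,
      fun c hc _ ↦ summitProperty_of_margin h₃ (h𝓓 c) (hQ c hc)⟩
  · exact absurd (hconst _ ▸ summitProperty_of_margin h₃ (h𝓓 _) (hQ _ hc₁)) hP

/-- The v6 crux composition recovered from v7's (`CaptureSufficesC2_of ∘ settlingKick_of_trackedCaptureSettles`). -/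
theorem CaptureSufficesC2_of_pointwise' (h₅ : Goal.stub_tameCensorship) (h₁k : Goal.stub_quietKick)
    (h₂k : Goal.stub_marginKick) (h₃ : Goal.stub_trackedCaptureSettles) :
    Summit.FinalStateConjecture.FinalStateConjecture.Theses.PhaseMixingCapture.CaptureSufficesC2 :=
  CaptureSufficesC2_of h₅ h₁k h₂k (settlingKick_of_trackedCaptureSettles h₃)

/-! ## §7 v1 ⟹ v3: the two-family forms imply the curve forms (each reshape is a weakening) -/

section Reshape

variable {X : Type*} [TopologicalSpace X] [ChartedSpace E3 X] [IsManifold (𝓡 3) ∞ X]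

/-- The diagonal `c ↦ (c, c)` of the parameter plane is smooth. [folklore] -/
theorem contDiff_diag : ContDiff ℝ ∞ (fun c : EuclideanSpace ℝ (Fin 1) ↦ !₂[c 0, c 0]) := by
  rw [contDiff_euclidean]
  intro i
  fin_cases i <;>
    simpa using (contDiff_piLp_apply (𝕜 := ℝ) (p := 2) (E := fun _ : Fin 1 => ℝ) (i := 0))

/-- v1's two-family relative witness along `Q`-curves (a tame 2-family `G` extending `F` along the
first axis, with injective immersed diagonal of `P`-members) yields v3's curve witness
(`e' := e`, `F' := c ↦ G (c, c)`); a fortiori v2's same-end curve witness does. [folklore] -/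
theorem tameCurveWitnessAlong_of_twoFamily {𝓓 : Set (InitialDataSet (𝓡 3) X)}
    {Q P : InitialDataSet (𝓡 3) X → Prop}
    (h : ∀ (e : AFEnd X) (F : EuclideanSpace ℝ (Fin 1) → InitialDataSet (𝓡 3) X),
      InitialDataSet.IsTameDataFamily e 1 F →
        ((InitialDataSet.IsImmersedAtZero 1 F ∧ Function.Injective F) ∨ ∀ c, F c = F 0) →
          (∀ c, F c ∈ 𝓓) → (∀ c ≠ 0, Q (F c)) →
        ∃ G : EuclideanSpace ℝ (Fin 2) → InitialDataSet (𝓡 3) X,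
          InitialDataSet.IsTameDataFamily e 2 G ∧ (∀ c, G !₂[c 0, 0] = F c) ∧ (∀ q, G q ∈ 𝓓) ∧
            Function.Injective (fun c : EuclideanSpace ℝ (Fin 1) ↦ G !₂[c 0, c 0]) ∧
            InitialDataSet.IsImmersedAtZero 1 (fun c : EuclideanSpace ℝ (Fin 1) ↦ G !₂[c 0, c 0]) ∧
            ∀ c : EuclideanSpace ℝ (Fin 1), c ≠ 0 → P (G !₂[c 0, c 0])) :
    TameCurveWitnessAlong 𝓓 Q P := by
  intro e F hF hdich h𝓓 hQ
  obtain ⟨G, hG, hGF, hG𝓓, hinj, himm, hP⟩ := h e F hF hdich h𝓓 hQ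
  have h0 : (!₂[(0 : EuclideanSpace ℝ (Fin 1)) 0, (0 : EuclideanSpace ℝ (Fin 1)) 0] :
      EuclideanSpace ℝ (Fin 2)) = 0 := by
    ext i; fin_cases i <;> simp
  refine ⟨e, fun c ↦ G !₂[c 0, c 0], InitialDataSet.IsTameDataFamily.comp_contDiff hG contDiff_diag h0, ?_, hinj,
    himm, fun c ↦ hG𝓓 _, hP⟩
  show G !₂[(0 : EuclideanSpace ℝ (Fin 1)) 0, (0 : EuclideanSpace ℝ (Fin 1)) 0] = F 0
  rw [← hGF 0]
  simp

end Reshape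


/-! ## §8 Logical position of the reshaped stubs (sorry-free): relative witnesses vs. plain tame
genericity of the target property -/

section Position

variable {X : Type*} [TopologicalSpace X] [ChartedSpace E3 X] [IsManifold (𝓡 3) ∞ X]

/-- **Curve witnesses from genericity of the target plus self-witnesses.** If `P` is tame-generic in
`𝓓` and through every `P`-datum of `𝓓` which is the base of a tame curve on some end passes a tame
injective immersed `𝓓`-curve of `P`-data (a SELF-WITNESS — for the summit's properties the expected
source is the breathing family `t ↦ (breathe t)^* d`, whose members are isometric copies of `d`),
then `P` has curve witnesses along `Q`-curves for EVERY `Q`: the base curve `F` is not used. So the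
relative form never asks more than "`P` generic + self-witnesses"; what it offers an engine is the
INPUT `F` (kick along the given `Q`-curve). [folklore] -/
theorem tameCurveWitnessAlong_of_generic {𝓓 : Set (InitialDataSet (𝓡 3) X)}
    {Q P : InitialDataSet (𝓡 3) X → Prop} (hP : InitialDataSet.IsTameChristodoulouGeneric 𝓓 P 1)
    (hself : ∀ (e : AFEnd X) (d : InitialDataSet (𝓡 3) X),
      InitialDataSet.IsTameDataFamily e 1 (fun _ : EuclideanSpace ℝ (Fin 1) ↦ d) → d ∈ 𝓓 → P d →
        ∃ (e' : AFEnd X) (F' : EuclideanSpace ℝ (Fin 1) → InitialDataSet (𝓡 3) X),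
          InitialDataSet.IsTameDataFamily e' 1 F' ∧ F' 0 = d ∧ Function.Injective F' ∧
            InitialDataSet.IsImmersedAtZero 1 F' ∧ (∀ c, F' c ∈ 𝓓) ∧ ∀ c ≠ 0, P (F' c)) :
    TameCurveWitnessAlong 𝓓 Q P := by
  intro e F hF _hdich h𝓓 _hQ
  by_cases hPd : P (F 0)
  · -- self-witness through the `P`-datum `F 0` (the constant curve at `F 0` is tame on `e`)
    obtain ⟨hs, hsole, ⟨M, hM, hSAF⟩, hlim⟩ := hF
    exact hself e (F 0) (InitialDataSet.isTameDataFamily_const hsole 1 (hSAF 0)) (h𝓓 0) hPd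
  · obtain ⟨e', F', hF', himm, h0, hinj, hD, hE⟩ := hP (F 0) ⟨h𝓓 0, hPd⟩
    refine ⟨e', F', hF', h0, hinj, himm, hD, fun c hc ↦ ?_⟩
    by_contra hPc
    exact hE c hc ⟨hD c, hPc⟩

/-- Conversely, **curve witnesses along `Q`-curves plus tame genericity of `Q` give tame genericity of
`P`** — this is `isTameChristodoulouGeneric_of_relative` read as an upper bound: the pair
(stub 1, stub 2) is at least "QUIET is tame-generic", the pair (generic QUIET, stub 3) at least
"MARGIN is tame-generic" (= item stmt-FinalStateConjecture-10854 re-typed tame, plus MGHD existence).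
[folklore] -/
theorem generic_of_tameCurveWitnessAlong {𝓓 : Set (InitialDataSet (𝓡 3) X)}
    {Q P : InitialDataSet (𝓡 3) X → Prop}
    (h𝓓 : ∀ d ∈ 𝓓, ∃ e : AFEnd X, e.IsSoleEnd ∧ ∃ M : ℝ, e.IsStronglyAsymptoticallyFlatDR d M)
    (hQ : InitialDataSet.IsTameChristodoulouGeneric 𝓓 Q 1) (hrel : TameCurveWitnessAlong 𝓓 Q P) :
    InitialDataSet.IsTameChristodoulouGeneric 𝓓 P 1 :=
  isTameChristodoulouGeneric_of_relative h𝓓 hQ hrel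

end Position

/-- **Stub 2 from tame genericity of QUIET plus quiet self-witnesses** (the censored base curve and
stub 1 are then idle): the logical ceiling of the hardest stub. -/
theorem quietAlongCensoredCurves_of_generic
    (hG : ∀ (X : Type) [TopologicalSpace X] [ChartedSpace E3 X] [IsManifold (𝓡 3) ∞ X] [T2Space X]
      [SecondCountableTopology X] [ConnectedSpace X],
      InitialDataSet.IsTameChristodoulouGeneric (admissibleVacuumData X) QuietProperty 1)
    (hself : ∀ (X : Type) [TopologicalSpace X] [ChartedSpace E3 X] [IsManifold (𝓡 3) ∞ X] [T2Space X]
      [SecondCountableTopology X] [ConnectedSpace X] (e : AFEnd X) (d : InitialDataSet (𝓡 3) X),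
      InitialDataSet.IsTameDataFamily e 1 (fun _ : EuclideanSpace ℝ (Fin 1) ↦ d) →
        d ∈ admissibleVacuumData X → QuietProperty d →
          ∃ (e' : AFEnd X) (F' : EuclideanSpace ℝ (Fin 1) → InitialDataSet (𝓡 3) X),
            InitialDataSet.IsTameDataFamily e' 1 F' ∧ F' 0 = d ∧ Function.Injective F' ∧
              InitialDataSet.IsImmersedAtZero 1 F' ∧ (∀ c, F' c ∈ admissibleVacuumData X) ∧
                ∀ c ≠ 0, QuietProperty (F' c)) :
    Goal.stub_quietAlongCensoredCurves := by
  intro X _ _ _ _ _ _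
  exact tameCurveWitnessAlong_of_generic (hG X) (hself X)

/-- **Stub 3 from tame genericity of MARGIN plus margin self-witnesses.** -/
theorem marginAlongQuietCurves_of_generic
    (hG : ∀ (X : Type) [TopologicalSpace X] [ChartedSpace E3 X] [IsManifold (𝓡 3) ∞ X] [T2Space X]
      [SecondCountableTopology X] [ConnectedSpace X],
      InitialDataSet.IsTameChristodoulouGeneric (admissibleVacuumData X) MarginProperty 1)
    (hself : ∀ (X : Type) [TopologicalSpace X] [ChartedSpace E3 X] [IsManifold (𝓡 3) ∞ X] [T2Space X]
      [SecondCountableTopology X] [ConnectedSpace X] (e : AFEnd X) (d : InitialDataSet (𝓡 3) X),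
      InitialDataSet.IsTameDataFamily e 1 (fun _ : EuclideanSpace ℝ (Fin 1) ↦ d) →
        d ∈ admissibleVacuumData X → MarginProperty d →
          ∃ (e' : AFEnd X) (F' : EuclideanSpace ℝ (Fin 1) → InitialDataSet (𝓡 3) X),
            InitialDataSet.IsTameDataFamily e' 1 F' ∧ F' 0 = d ∧ Function.Injective F' ∧
              InitialDataSet.IsImmersedAtZero 1 F' ∧ (∀ c, F' c ∈ admissibleVacuumData X) ∧
                ∀ c ≠ 0, MarginProperty (F' c)) :
    Goal.stub_marginAlongQuietCurves := by
  intro X _ _ _ _ _ _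
  exact tameCurveWitnessAlong_of_generic (hG X) (hself X)

/-- **(stub 1, stub 2) give tame genericity of QUIET; (that, stub 3) give tame genericity of MARGIN.**
The intermediate conclusions of the composition, exposed. -/
theorem generic_margin_of_stubs (h₅ : Goal.stub_tameCensorship) (h₁ : Goal.stub_quietAlongCensoredCurves)
    (h₂ : Goal.stub_marginAlongQuietCurves) (X : Type) [TopologicalSpace X] [ChartedSpace E3 X]
    [IsManifold (𝓡 3) ∞ X] [T2Space X] [SecondCountableTopology X] [ConnectedSpace X] :
    InitialDataSet.IsTameChristodoulouGeneric (admissibleVacuumData X) QuietProperty 1 ∧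
      InitialDataSet.IsTameChristodoulouGeneric (admissibleVacuumData X) MarginProperty 1 := by
  have h𝓓 : ∀ d ∈ admissibleVacuumData X,
      ∃ e : AFEnd X, e.IsSoleEnd ∧ ∃ M : ℝ, e.IsStronglyAsymptoticallyFlatDR d M :=
    fun d hd ↦ exists_isSoleEnd_of_mem_admissibleVacuumData hd
  have gQ := generic_of_tameCurveWitnessAlong h𝓓 (h₅ X) (h₁ X)
  exact ⟨gQ, generic_of_tameCurveWitnessAlong h𝓓 gQ (h₂ X)⟩

end Summit.FinalStateConjecture.FinalStateConjecture.Cruxes.CaptureSufficesC2.CensorshipEntersDiagonally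

end
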